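import Summits.QuantumFields.YangMills.Theorems.UnitScaleTiltProp7ChartRemainderAbstractTrisection
import Summits.QuantumFields.YangMills.Theorems.UnitScaleTiltProp7GaugePieceDivLipschitz
import Summits.QuantumFields.YangMills.Theorems.UnitScaleTiltProp7ConjPieceDivLipschitz
import Summits.QuantumFields.YangMills.Theorems.UnitScaleTiltProp7BCHPiecePackaged
import HarnessLib

/-!
# Prop 7, route-R E′, (E1-c) F4h — THE CHART REMAINDER UNDER `ℓ²D*_W`: THE DIVERGENCE-LIPSCHITZ ROW `ℓ²‖D*[N(ψ) − N(ψ′)](x)‖ ≤ (P₁ rows) + (P₂ rows) + (P₃ rows)`, ONE THEOREM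

Route `UnitScaleTilt`, crux K1 child «MinimiserStabilityRegPr» (`stmt-QuantumFields-19200`), cell ym3-torus, width seat px15 (gen 2); pen «px15 g2: (E1-c) GO-LOCATE» (★p1 g15,
2026-08-28T20:45:05Z), LOCATE `LOCATE-E1C-DIVLIPSCHITZ-px15g2.md` (the whole of §6).  THEOREMS ONLY (0 `def`, 0 `sorry`); `--supports stmt-QuantumFields-19200`, count-neutral.
YM₃ on T³ is a ladder rung (R3), not the Clay problem; nothing here claims the stub, the crux, d = 4 or the mass gap.

WHAT.  In F1's abstract lattice letters over `M_N(ℂ)` (shifts `T`, unitary transports `U`: norm-preserving both ways and *-compatible), for Hermitian-type site fields `ψ, ψ′`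
(`(c•ψ)* = −c•ψ`, `|c| ≤ 1`) pinned on `C` with a potential `d` toward `C`, and data `E(μ,y)` (`‖E − 1‖ < 1`, `B := log E`, `‖B‖ ≤ β ≤ 1∕40`), the chart remainder
`N(ψ)(μ,y) = log(u(y)·E·(R(U)u(T y))*) − log E + c•D_μψ(y)`, `u = e^{c•ψ}`, obeys
  ★★★ `norm_divB_chartRemainder_sub_le`: `ℓ²‖D*[N(ψ) − N(ψ′)](x)‖ ≤ [P₁: F4d(ii)] + [P₂: F4c(iv-c)] + [P₃: F4g]`
— the three brackets verbatim from ✓p674368 `norm_divB_conjPiece_sub_le` (in the `u`-rows `mᵘ_d, δᵘ′, δᵘ_d` and the data rows `β`, `ℓ²‖D*B(x)‖`), ✓p673331 `norm_divB_gaugePiece_sub_le` (in the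
`ψ`-rows `m, m′, m_d, δ, δ′, δ_d`, the `ρ₃`-weights `ℓ·min(d x,ℓ)‖D*(−c•D(ψ−ψ′))(x)‖`, `ℓ·min(d x,ℓ)‖D*(−c•Dψ′)(x)‖`) and ⧗p675104 `norm_divB_bchPiece_le` (`2|ι|ℓ²β(24K mᵘ_d + 8δᵘ_d)`),
glued by F4f ✓p674854 `chartRemainder_eq_three_pieces` and additivity of `D*`.  The `u`-rows reduce to `ψ`-rows by F4d(iii) ✓p674383; every summand is (a row of `ψ` or `ψ′` or of the
data) × (a row of `ψ − ψ′`), i.e. the `ℓ²D*`-member of `q(Nψ − Nψ′) ≤ C_N(pψ + pψ′ + s)·p(ψ − ψ′)` for ✓p667460.  HONEST SCOPE.  Assembly ([folklore]); what remains is the `ℓ·sup`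
member (F4c(v) + F4d(i) + F4g bond rows, same gluing) and the torus∕`(p,q)` instantiation — no analytic step.

References: T. Bałaban, CMP 98 (1985) 17–51 [Balaban1985Averaging] ((19)–(21) p.21, (26), (32)–(34) p.22); CMP 99 (1985) 389–434 [Balaban1985BackgroundPropagators] ((3.8) p.392).
-/

set_option autoImplicit false

noncomputable section

open scoped BigOperators Matrix.Norms.L2Operator Matrix
open NormedSpace

namespace Summit.QuantumFields.YangMills.Theorems.Prop7ChartRemainderDivLipschitz

open Literature.MathematicalPhysics.QuantumFieldTheory.Balaban1983to89
open Finset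
open MatrixLog (mlog)
open B9Eq39Adjoint (R covD covDstar divB)
open Literature.Analysis.Complex (logOnePlus)
open Summit.QuantumFields.YangMills.Theorems.Prop7ChartRemainderAbstractTrisection (chartRemainder_eq_three_pieces expField_unitary)
open Summit.QuantumFields.YangMills.Theorems.Prop7GaugePieceDivLipschitz (norm_divB_gaugePiece_sub_le divB_add')
open Summit.QuantumFields.YangMills.Theorems.Prop7ConjPieceDivLipschitz (norm_divB_conjPiece_sub_le)
open Summit.QuantumFields.YangMills.Theorems.Prop7BCHPiecePackaged (norm_divB_bchPiece_le norm_gaugeLog_le)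
open Summit.QuantumFields.YangMills.Theorems.Prop7ResumPartPackaged (covD_sub)

variable {n : Type*} [Fintype n] [DecidableEq n] [Nonempty n]
variable {S : Type*} {ι : Type*} [Fintype ι] (T : ι → Equiv.Perm S) (U : ι → S → (Matrix n n ℂ)ˣ)

/-- ★★★ **THE CHART REMAINDER UNDER `ℓ²D*`, DIVERGENCE-LIPSCHITZ ROW** (see the module docstring for the letters; the right-hand side is the sum of the three piece-rows verbatim).
[cite: Balaban1985Averaging, (19)-(21) p.21, (32)-(34) p.22] [cite: Balaban1985BackgroundPropagators, (3.8) p.392] -/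
theorem norm_divB_chartRemainder_sub_le
    (hR : ∀ μ x (M : Matrix n n ℂ), ‖R (U μ x) M‖ = ‖M‖) (hRn : ∀ μ x (M : Matrix n n ℂ), ‖R (U μ x)⁻¹ M‖ = ‖M‖)
    (hstarR : ∀ μ y (M : Matrix n n ℂ), star (R (U μ y) M) = R (U μ y) (star M))
    (hstarRinv : ∀ μ y (M : Matrix n n ℂ), R (U μ y)⁻¹ (star M) = star (R (U μ y)⁻¹ M))
    {c : ℂ} (hc : ‖c‖ ≤ 1) (ψ ψ' : S → Matrix n n ℂ)
    (hskew : ∀ y, star (c • ψ y) = -(c • ψ y)) (hskew' : ∀ y, star (c • ψ' y) = -(c • ψ' y))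
    (hu1 : ∀ y, ‖exp (c • ψ y)‖ ≤ 1) (hu1' : ∀ y, ‖exp (c • ψ' y)‖ ≤ 1)
    (En : ι → S → Matrix n n ℂ) (hE : ∀ μ y, ‖En μ y - 1‖ < 1) {β : ℝ} (hβ : ∀ μ y, ‖mlog (En μ y)‖ ≤ β) (hβ40 : β ≤ 1 / 40)
    -- ψ-rows (P₂)
    {R₀ m m' md δ δ' δd : ℝ}
    (hm : ∀ y, ‖ψ y‖ ≤ m) (hmR : m ≤ R₀) (hmhalf : m ≤ 1 / 2) (hm' : ∀ y, ‖ψ' y‖ ≤ m') (hm'R : m' ≤ R₀) (hmd : ∀ y, ‖ψ y - ψ' y‖ ≤ md)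
    (hδ0 : 0 ≤ δ) (hδ : ∀ μ y, ‖covD T U μ ψ y‖ ≤ δ) (hδ'0 : 0 ≤ δ') (hδ' : ∀ μ y, ‖covD T U μ ψ' y‖ ≤ δ')
    (hδd0 : 0 ≤ δd) (hδd : ∀ μ y, ‖covD T U μ (fun z => ψ z - ψ' z) y‖ ≤ δd)
    (C : Set S) (hC : ∀ y ∈ C, ψ y = 0) (hC' : ∀ y ∈ C, ψ' y = 0)
    (d : S → ℕ) (hd : ∀ y, y ∉ C → ∃ μ, d (T μ y) + 1 ≤ d y ∨ d ((T μ).symm y) + 1 ≤ d y)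
    (hs : Real.exp R₀ * Real.exp (R₀ + (δ + δ')) * (δ + δ') ≤ 1 / 2)
    -- u-rows (P₁, P₃), `u = e^{c•ψ}`
    {mud K δud : ℝ} (hmud : ∀ y, ‖exp (c • ψ y) - exp (c • ψ' y)‖ ≤ mud) (hK0 : 0 ≤ K)
    (hDu : ∀ μ y, ‖covD T U μ (fun z => exp (c • ψ z)) y‖ ≤ K) (hDu' : ∀ μ y, ‖covD T U μ (fun z => exp (c • ψ' z)) y‖ ≤ K) (hK : K ≤ 1 / 80)
    (hδud : ∀ μ y, ‖covD T U μ (fun z => exp (c • ψ z) - exp (c • ψ' z)) y‖ ≤ δud) (ℓ : ℕ) (x : S) :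
    (ℓ : ℝ) ^ 2 * ‖divB T U (fun μ y =>
        (mlog (exp (c • ψ y) * En μ y * star (R (U μ y) (exp (c • ψ (T μ y))))) - mlog (En μ y) + c • covD T U μ ψ y)
        - (mlog (exp (c • ψ' y) * En μ y * star (R (U μ y) (exp (c • ψ' (T μ y))))) - mlog (En μ y) + c • covD T U μ ψ' y)) x‖
      ≤ (2 * ‖exp (c • ψ x) - exp (c • ψ' x)‖ * ((ℓ : ℝ) ^ 2 * ‖divB T U (fun μ y => mlog (En μ y)) x‖)
            + 4 * (Fintype.card ι : ℝ) * (ℓ : ℝ) ^ 2 * ((δud + 4 * K * mud) * β))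
        + ((2 * max ((ℓ : ℝ) * δ) m * ((ℓ : ℝ) * min (d x : ℝ) ℓ * ‖divB T U (fun μ y => (-c) • covD T U μ (fun z => ψ z - ψ' z) y) x‖)
            + 2 * Real.exp (2 * R₀) * max ((ℓ : ℝ) * δd) md * ((ℓ : ℝ) * min (d x : ℝ) ℓ * ‖divB T U (fun μ y => (-c) • covD T U μ ψ' y) x‖)
            + (Fintype.card ι : ℝ) * (ℓ : ℝ) ^ 2 * (2 * Real.exp (2 * R₀) * δ * δd + 2 * Real.exp (2 * R₀) * (δd + 4 * δ' * md) * δ')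
            + 2 * (Fintype.card ι : ℝ) * (ℓ : ℝ) ^ 2 *
              ((((Real.exp R₀ * Real.exp (R₀ + (δ + δ'))) + 2 * (Real.exp R₀ * Real.exp (R₀ + (δ + δ'))) ^ 2) * (δ + δ') * δd)
                + ((4 / 3 * (Real.exp R₀ * Real.exp (R₀ + (δ + δ'))) + 6 * (Real.exp R₀ * Real.exp (R₀ + (δ + δ'))) ^ 2) * (δ + δ') ^ 2 * md))))
        + 2 * (Fintype.card ι : ℝ) * (ℓ : ℝ) ^ 2 * (β * (24 * K * mud + 8 * δud)) := by
  -- unitarity of `u = e^{c•ψ}` and `‖Q − 1‖ < 1`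
  have huu : ∀ y, exp (c • ψ y) * star (exp (c • ψ y)) = 1 := fun y => (expField_unitary (hskew y)).1
  have huu' : ∀ y, exp (c • ψ' y) * star (exp (c • ψ' y)) = 1 := fun y => (expField_unitary (hskew' y)).1
  have hK2 : K ≤ 1 / 2 := hK.trans (by norm_num)
  have hQ : ∀ μ y, ‖exp (c • ψ y) * star (R (U μ y) (exp (c • ψ (T μ y)))) - 1‖ < 1 := fun μ y =>
    ((norm_gaugeLog_le T U μ (u := fun z => exp (c • ψ z)) hu1 huu y (hDu μ y) hK2).1).trans_lt (by linarith)
  have hQ' : ∀ μ y, ‖exp (c • ψ' y) * star (R (U μ y) (exp (c • ψ' (T μ y)))) - 1‖ < 1 := fun μ y =>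
    ((norm_gaugeLog_le T U μ (u := fun z => exp (c • ψ' z)) hu1' huu' y (hDu' μ y) hK2).1).trans_lt (by linarith)
  -- the trisection, bondwise, regrouped as (P₁ − P₁′) + ((P₂ − P₂′) + (P₃ − P₃′))
  have hN : (fun μ y =>
        (mlog (exp (c • ψ y) * En μ y * star (R (U μ y) (exp (c • ψ (T μ y))))) - mlog (En μ y) + c • covD T U μ ψ y)
        - (mlog (exp (c • ψ' y) * En μ y * star (R (U μ y) (exp (c • ψ' (T μ y))))) - mlog (En μ y) + c • covD T U μ ψ' y))
      = fun μ y =>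
        ((exp (c • ψ y) * mlog (En μ y) * star (exp (c • ψ y)) - mlog (En μ y))
          - (exp (c • ψ' y) * mlog (En μ y) * star (exp (c • ψ' y)) - mlog (En μ y)))
        + (((logOnePlus (exp (-((-c) • ψ y)) * (exp ((-c) • ψ y + (-c) • covD T U μ ψ y) - exp ((-c) • ψ y))) - (-c) • covD T U μ ψ y)
            - (logOnePlus (exp (-((-c) • ψ' y)) * (exp ((-c) • ψ' y + (-c) • covD T U μ ψ' y) - exp ((-c) • ψ' y))) - (-c) • covD T U μ ψ' y))
          + ((mlog (exp (exp (c • ψ y) * mlog (En μ y) * star (exp (c • ψ y))) * exp (mlog (exp (c • ψ y) * star (R (U μ y) (exp (c • ψ (T μ y)))))))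
                - exp (c • ψ y) * mlog (En μ y) * star (exp (c • ψ y)) - mlog (exp (c • ψ y) * star (R (U μ y) (exp (c • ψ (T μ y))))))
            - (mlog (exp (exp (c • ψ' y) * mlog (En μ y) * star (exp (c • ψ' y))) * exp (mlog (exp (c • ψ' y) * star (R (U μ y) (exp (c • ψ' (T μ y)))))))
                - exp (c • ψ' y) * mlog (En μ y) * star (exp (c • ψ' y)) - mlog (exp (c • ψ' y) * star (R (U μ y) (exp (c • ψ' (T μ y)))))))) := by
    funext μ y
    rw [chartRemainder_eq_three_pieces T U hstarR ψ hskew En μ y (hE μ y) (hQ μ y),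
      chartRemainder_eq_three_pieces T U hstarR ψ' hskew' En μ y (hE μ y) (hQ' μ y)]
    abel
  rw [hN, divB_add', divB_add']
  have hℓ2 : 0 ≤ (ℓ : ℝ) ^ 2 := sq_nonneg _
  -- P₁
  have hP1 := norm_divB_conjPiece_sub_le T U hRn hstarRinv (fun z => exp (c • ψ z)) (fun z => exp (c • ψ' z)) hu1 hu1'
    hmud hK0 hDu' hδud (fun μ y => mlog (En μ y)) hβ ℓ x
  beta_reduce at hP1
  -- P₂ (scalar −c)
  have hnc : ‖-c‖ ≤ 1 := by rwa [norm_neg]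
  have hP2 := norm_divB_gaugePiece_sub_le T U hR hRn hnc ψ ψ' hm hmR hmhalf hm' hm'R hmd hδ0 hδ hδ'0 hδ' hδd0 hδd C hC hC' d hd hs ℓ x
  -- P₃
  have hδud' : ∀ μ y, ‖covD T U μ (fun z => exp (c • ψ z)) y - covD T U μ (fun z => exp (c • ψ' z)) y‖ ≤ δud := fun μ y => by
    rw [← covD_sub]; exact hδud μ y
  have hP3 := norm_divB_bchPiece_le T U hRn (u := fun z => exp (c • ψ z)) (u' := fun z => exp (c • ψ' z)) hu1 hu1' huu huu'
    (fun μ y => mlog (En μ y)) hβ hβ40 hDu hDu' hK hmud hδud' ℓ x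
  beta_reduce at hP3
  -- glue: triangle inequality under `ℓ²`, then the three piece-rows
  refine (mul_le_mul_of_nonneg_left ((norm_add_le _ _).trans (add_le_add le_rfl (norm_add_le _ _))) hℓ2).trans ?_
  linarith [hP1, hP2, hP3]

end Summit.QuantumFields.YangMills.Theorems.Prop7ChartRemainderDivLipschitz

end
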